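import Summits.CriticalPhenomena.PercolationContinuityZ3.Theorems.PercNearOneGluingNoHeavyLowerTailWorstPairExchangeCex

/-!
# `NoHeavyLowerTail` (stmt-CriticalPhenomena-4575) — the exchange row "EX_obs" is FALSE:
# a certified weighted counterexample on seven vertices (kernel no-go `not_EXobs`)

Prover `prim-lf-5` (lemma factory #5), `--supports stmt-CriticalPhenomena-4575`.  No named facts, no sorries; the
`def`s are computable checkers and witness data only (pattern of `…MLnaCexChecker.lean`).

EX_obs (crux evidence LF5-CANDIDATES.md §A2, census request `lf5-ex-obs-exchange`) was the cross term of the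
cluster-revealment identity at the observer's favourite relay: for the lightness champion `c` and the relay
`y⋆ ≠ c` maximising `P(o ↔ y)`, with `xor = {exactly one of o, c is joined to y⋆}`,
`P(1 ≤ N ≤ j, xor) ≤ P(|π(c)| ≤ j, xor)`.  It survived 54 000 random instances and direct climbs at (5,2)/(4,2) but the
ttrl2 census (`run/shared/lean/ttrl/exobs/README.md`, RESULT 03:15Z) refuted it at `(|A|, j) = (6, 2)`.  This file
certifies the tie-free witness in the kernel:

WITNESS (`wit62`, `n = 7`, observer `0`, relays `A = {1,…,6}`, level `j = 2`): `w(0,4) = 109/2000`, `w(0,5) = 23/400`,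
`w(1,2) = 1531/2500`, `w(2,5) = 1287/5000`, `w(3,4) = 3631/5000`, `w(4,6) = 2207/10000`.  The UNIQUE champion is
`c = 1` (`I(1) = 10529603/12500000` exceeds the five other lightnesses), the UNIQUE maximiser of `P(o ↔ y)` over `y ≠ 1`
is `y⋆ = 5` (`23/400`), and `P(1 ≤ N ≤ 2, xor) − P(|π(1)| ≤ 2, xor) = 2328003519942135243/5·10²⁰ > 0`.
-/

namespace Summit.CriticalPhenomena.PercolationContinuityZ3.Theorems

open MeasureTheory
open Literature.Probability.LatticeModels Literature.Probability.Percolation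
open Summit.CriticalPhenomena.PercolationContinuityZ3.Theorems.AdditiveGluing.Negative.Cert

namespace EXobsCex

/-- The witness: `04: 109/2000, 05: 23/400, 12: 1531/2500, 25: 1287/5000, 34: 3631/5000, 46: 2207/10000`. -/
def wit62 : List (Fin 7 × Fin 7 × ℚ) :=
  [(0, 4, 109/2000), (0, 5, 23/400), (1, 2, 1531/2500), (2, 5, 1287/5000), (3, 4, 3631/5000), (4, 6, 2207/10000)]

/-- The listed pairs are distinct. [this file] -/
theorem wit62_nodup : (wPairs wit62).Nodup := by decide

/-- The witness weights lie in `[0, 1]`. [this file] -/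
theorem wit62_weights : ∀ e ∈ wit62, 0 ≤ e.2.2 ∧ e.2.2 ≤ 1 := by
  intro e he
  simp only [wit62, List.mem_cons, List.not_mem_nil, or_false] at he
  rcases he with rfl | rfl | rfl | rfl | rfl | rfl <;> norm_num

/-- The relay set `{1,…,6}`. -/
def A6 : Finset (Fin 7) := {1, 2, 3, 4, 5, 6}

/-- Number of relays reachable from `x` according to a reach table. -/
def nrel (tb : List ℕ) (x : Fin 7) : ℕ :=
  (A6.filter fun z : Fin 7 => (tb.getD x.val 0).testBit z.val = true).card

/-- `|π(a)| ≤ 2`. -/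
def lightB (tb : List ℕ) (a : Fin 7) : Bool := decide (nrel tb a ≤ 2)

/-- `o ↔ y`. -/
def connB (tb : List ℕ) (y : Fin 7) : Bool := (tb.getD 0 0).testBit y.val

/-- `1 ≤ N ≤ 2` and exactly one of `o = 0`, `c = 1` is joined to `y⋆ = 5`. -/
def badXorB (tb : List ℕ) : Bool :=
  decide ((1 ≤ nrel tb 0 ∧ nrel tb 0 ≤ 2) ∧ ((tb.getD 0 0).testBit 5 = true ↔ ¬ (tb.getD 1 0).testBit 5 = true))

/-- `|π(1)| ≤ 2` and exactly one of `o = 0`, `c = 1` is joined to `y⋆ = 5`. -/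
def lightXorB (tb : List ℕ) : Bool :=
  decide (nrel tb 1 ≤ 2 ∧ ((tb.getD 0 0).testBit 5 = true ↔ ¬ (tb.getD 1 0).testBit 5 = true))

/-- Exact weighted counts. -/
def cntLight (a : Fin 7) : ℚ := ((wtabs 7 wit62).map fun t => if lightB t.1 a then t.2 else 0).sum
/-- Exact weighted count of `o ↔ y`. -/
def cntConn (y : Fin 7) : ℚ := ((wtabs 7 wit62).map fun t => if connB t.1 y then t.2 else 0).sum
/-- Exact weighted count of the left-hand event. -/
def cntBadXor : ℚ := ((wtabs 7 wit62).map fun t => if badXorB t.1 then t.2 else 0).sum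
/-- Exact weighted count of the right-hand event. -/
def cntLightXor : ℚ := ((wtabs 7 wit62).map fun t => if lightXorB t.1 then t.2 else 0).sum

open scoped Classical in
/-- Per-configuration agreement of the relay count. [this file] -/
theorem nrel_reachTable (ω : List (Fin 7 × Fin 7)) (x : Fin 7) :
    nrel (reachTable 7 ω) x = (A6.filter fun z => (↑(Eset ω) : Set (Sym2 (Fin 7))) ∈ openConn x z).card := by
  unfold nrel
  rw [Finset.filter_congr fun z _ => testBit_reachTable_iff_mem_openConn ω x z]

open scoped Classical in
/-- `I_2(a) = cntLight a`. [this file] -/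
theorem real_light (a : Fin 7) :
    (prodBernoulli (wOfList wit62)).real
        {ω : BondConfig (Fin 7) | (A6.filter fun x => ω ∈ openConn a x).card ≤ 2} = (cntLight a : ℝ) := by
  refine WorstPairExchangeCex.real_eq_wcount wit62_nodup wit62_weights (fun tb => lightB tb a) _ fun ω => ?_
  simp only [lightB, decide_eq_true_eq, Set.mem_setOf_eq, nrel_reachTable]

open scoped Classical in
/-- `P(o ↔ y) = cntConn y`. [this file] -/
theorem real_conn (y : Fin 7) :
    (prodBernoulli (wOfList wit62)).real (openConn (0 : Fin 7) y : Set (BondConfig (Fin 7))) = (cntConn y : ℝ) := by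
  refine WorstPairExchangeCex.real_eq_wcount wit62_nodup wit62_weights (fun tb => connB tb y) _ fun ω => ?_
  simp only [connB]
  exact testBit_reachTable_iff_mem_openConn ω 0 y

open scoped Classical in
/-- The left-hand event as a count. [this file] -/
theorem real_badXor :
    (prodBernoulli (wOfList wit62)).real
        {ω : BondConfig (Fin 7) |
          (1 ≤ (A6.filter fun x => ω ∈ openConn (0 : Fin 7) x).card ∧ (A6.filter fun x => ω ∈ openConn (0 : Fin 7) x).card ≤ 2) ∧
            (ω ∈ openConn (0 : Fin 7) (5 : Fin 7) ↔ ω ∉ openConn (1 : Fin 7) (5 : Fin 7))} = (cntBadXor : ℝ) := by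
  refine WorstPairExchangeCex.real_eq_wcount wit62_nodup wit62_weights (fun tb => badXorB tb) _ fun ω => ?_
  have e05 : ((reachTable 7 ω).getD 0 0).testBit 5 = true ↔ (↑(Eset ω) : Set (Sym2 (Fin 7))) ∈ openConn (0 : Fin 7) (5 : Fin 7) :=
    testBit_reachTable_iff_mem_openConn ω 0 5
  have e15 : ((reachTable 7 ω).getD 1 0).testBit 5 = true ↔ (↑(Eset ω) : Set (Sym2 (Fin 7))) ∈ openConn (1 : Fin 7) (5 : Fin 7) :=
    testBit_reachTable_iff_mem_openConn ω 1 5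
  simp only [badXorB, decide_eq_true_eq, Set.mem_setOf_eq, nrel_reachTable, e05, e15]

open scoped Classical in
/-- The right-hand event as a count. [this file] -/
theorem real_lightXor :
    (prodBernoulli (wOfList wit62)).real
        {ω : BondConfig (Fin 7) |
          (A6.filter fun x => ω ∈ openConn (1 : Fin 7) x).card ≤ 2 ∧
            (ω ∈ openConn (0 : Fin 7) (5 : Fin 7) ↔ ω ∉ openConn (1 : Fin 7) (5 : Fin 7))} = (cntLightXor : ℝ) := by
  refine WorstPairExchangeCex.real_eq_wcount wit62_nodup wit62_weights (fun tb => lightXorB tb) _ fun ω => ?_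
  have e05 : ((reachTable 7 ω).getD 0 0).testBit 5 = true ↔ (↑(Eset ω) : Set (Sym2 (Fin 7))) ∈ openConn (0 : Fin 7) (5 : Fin 7) :=
    testBit_reachTable_iff_mem_openConn ω 0 5
  have e15 : ((reachTable 7 ω).getD 1 0).testBit 5 = true ↔ (↑(Eset ω) : Set (Sym2 (Fin 7))) ∈ openConn (1 : Fin 7) (5 : Fin 7) :=
    testBit_reachTable_iff_mem_openConn ω 1 5
  simp only [lightXorB, decide_eq_true_eq, Set.mem_setOf_eq, nrel_reachTable, e05, e15]

/-- The arithmetic at the witness (exact rational counts over `2⁶` configurations): `1` is the unique champion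
(`I(a) ≤ I(1)` for `a = 2,…,6`). [this file] -/
theorem facts_champ :
    cntLight 2 ≤ cntLight 1 ∧ cntLight 3 ≤ cntLight 1 ∧ cntLight 4 ≤ cntLight 1 ∧ cntLight 5 ≤ cntLight 1 ∧
      cntLight 6 ≤ cntLight 1 := by
  decide +kernel

/-- `5` maximises `P(o ↔ y)` over `y ≠ 1`. [this file] -/
theorem facts_fav : cntConn 2 ≤ cntConn 5 ∧ cntConn 3 ≤ cntConn 5 ∧ cntConn 4 ≤ cntConn 5 ∧ cntConn 6 ≤ cntConn 5 := by
  decide +kernel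

/-- The exchange row fails at the witness. [this file] -/
theorem facts_viol : cntLightXor < cntBadXor := by
  decide +kernel

end EXobsCex

open EXobsCex
open scoped Classical

/-- **The exchange row EX_obs is FALSE** (kernel no-go).  EX_obs: for every weighted graph, relay set `A`,
observer `o ∉ A`, level `j`, every lightness champion `c ∈ A` and every relay `y⋆ ∈ A`, `y⋆ ≠ c`, maximising
`P(o ↔ y)` over `y ∈ A ∖ {c}`:  `P(1 ≤ N ≤ j ∧ (o ↔ y⋆ xor c ↔ y⋆)) ≤ P(|π(c)| ≤ j ∧ (o ↔ y⋆ xor c ↔ y⋆))`.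
Refuted at `n = 7`, `A = {1,…,6}`, `o = 0`, `j = 2`, weights `EXobsCex.wit62`, `c = 1`, `y⋆ = 5`.
[this file; census run/shared/lean/ttrl/exobs/README.md] -/
theorem not_EXobs :
    ¬ (∀ (n : ℕ) (w : Sym2 (Fin n) → unitInterval) (A : Finset (Fin n)) (o : Fin n) (j : ℕ) (c yStar : Fin n),
        o ∉ A → c ∈ A → yStar ∈ A → yStar ≠ c →
        (∀ a ∈ A, (prodBernoulli w).real {ω : BondConfig (Fin n) | (A.filter fun x => ω ∈ openConn a x).card ≤ j} ≤
          (prodBernoulli w).real {ω : BondConfig (Fin n) | (A.filter fun x => ω ∈ openConn c x).card ≤ j}) →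
        (∀ y ∈ A, y ≠ c → (prodBernoulli w).real (openConn o y) ≤ (prodBernoulli w).real (openConn o yStar)) →
        (prodBernoulli w).real {ω : BondConfig (Fin n) |
            (1 ≤ (A.filter fun x => ω ∈ openConn o x).card ∧ (A.filter fun x => ω ∈ openConn o x).card ≤ j) ∧
              (ω ∈ openConn o yStar ↔ ω ∉ openConn c yStar)} ≤
          (prodBernoulli w).real {ω : BondConfig (Fin n) |
            (A.filter fun x => ω ∈ openConn c x).card ≤ j ∧ (ω ∈ openConn o yStar ↔ ω ∉ openConn c yStar)}) := by
  intro h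
  obtain ⟨h2, h3, h4, h5, h6⟩ := facts_champ
  obtain ⟨k2, k3, k4, k6⟩ := facts_fav
  have hchamp : ∀ a ∈ A6, (prodBernoulli (wOfList wit62)).real {ω : BondConfig (Fin 7) |
        (A6.filter fun x => ω ∈ openConn a x).card ≤ 2} ≤
      (prodBernoulli (wOfList wit62)).real {ω : BondConfig (Fin 7) | (A6.filter fun x => ω ∈ openConn (1 : Fin 7) x).card ≤ 2} := by
    intro a ha
    have hmem : a = 1 ∨ a = 2 ∨ a = 3 ∨ a = 4 ∨ a = 5 ∨ a = 6 := by
      simpa only [A6, Finset.mem_insert, Finset.mem_singleton] using ha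
    rcases hmem with rfl | rfl | rfl | rfl | rfl | rfl
    · exact le_rfl
    · rw [real_light, real_light]; exact_mod_cast h2
    · rw [real_light, real_light]; exact_mod_cast h3
    · rw [real_light, real_light]; exact_mod_cast h4
    · rw [real_light, real_light]; exact_mod_cast h5
    · rw [real_light, real_light]; exact_mod_cast h6
  have hfav : ∀ y ∈ A6, y ≠ (1 : Fin 7) → (prodBernoulli (wOfList wit62)).real (openConn (0 : Fin 7) y) ≤
      (prodBernoulli (wOfList wit62)).real (openConn (0 : Fin 7) (5 : Fin 7)) := by
    intro y hy hne
    have hmem : y = 1 ∨ y = 2 ∨ y = 3 ∨ y = 4 ∨ y = 5 ∨ y = 6 := by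
      simpa only [A6, Finset.mem_insert, Finset.mem_singleton] using hy
    rcases hmem with rfl | rfl | rfl | rfl | rfl | rfl
    · exact absurd rfl hne
    · rw [real_conn, real_conn]; exact_mod_cast k2
    · rw [real_conn, real_conn]; exact_mod_cast k3
    · rw [real_conn, real_conn]; exact_mod_cast k4
    · exact le_rfl
    · rw [real_conn, real_conn]; exact_mod_cast k6
  have hmain := h 7 (wOfList wit62) A6 0 2 1 5 (by decide) (by decide) (by decide) (by decide) hchamp hfav
  rw [real_badXor, real_lightXor] at hmain
  exact absurd hmain (not_le.mpr (by exact_mod_cast facts_viol))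

end Summit.CriticalPhenomena.PercolationContinuityZ3.Theorems
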